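/-
Copyright (c) 2026 the pub-hodgecm-mathlib formalisation cell (harness21).  Prover seat hodgecm-mathlib-LH4-p06 (g3): Track A «(D-RAM) FOUR-FRAME» squad of crux H413
(dealer LH4-plan (g11) WORD #17: «(ρ2b) — whole leaf, cutter + payer-of-record: (ρ2b) := (ρ2b-G) law-free ⊕ (ρ2b-L) law₂ at the κ-gate»), 2026-09-04.
-/
import Summits.HodgeConjecture.HodgeConjecture.Theorems.F0P3cDyRamRowTwoAtCoefStar            -- ★ p856034 (LH4-p06 (g2)): ROW (2) at coef* from (ρ2a) ∧ (ρ2b); brings `hFamily`, `shiftR`, the (ρ) vocabulary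
import Summits.HodgeConjecture.HodgeConjecture.Theorems.F0P3cDyRamAnchorCountDictionaryZero     -- ★ p854635 (LH4-p01): `isCompact_and_isOpen_of_forall_mem_iff_mapGL_eq` (`K_t` compact open); brings ★ `classOrbitalIntegral_indicator_complex_local_eq_natCard_fixedBy_mul`
import Literature.NumberTheory.Rogawski1990.UnitFundamentalLemmaNonsplitTwoClassesAssembly       -- ★ p847309: `exists_signedPair_finsum_delta_mul_classOrbitalIntegral_eq_mul_sub` (the two type-(2) classes and their exhaustion; place-generic)
import Literature.NumberTheory.Automorphic.UnitaryTypeTwoNormPairCentralizerCompactRamified       -- ★ p846839: `compactSpace_centralizer_of_isLocalNormPair_of_not_exists_isRoot_nonsplit` (any non-split place)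
import Literature.NumberTheory.Rogawski1990.LocalTransferLinear                                   -- ★ `isRegularElt_of_isLocalNormPair`
import Literature.NumberTheory.Rogawski1990.LocalNormPairOfSimilitudeFrame                          -- ★ `exists_isLocalNormPair_of_formCongr` (a match exists; frame `T = 1` for `Φ₃`)
import Summits.HodgeConjecture.HodgeConjecture.Theorems.F0P3cDyRamFourFrameHSideDefs              -- DEFS LEAF №2c (opened by the Lines module; imported so the `open` lines below mirror it exactly)
import Summits.HodgeConjecture.HodgeConjecture.Theorems.F0P3cDyRamFourFrameHSideDefsR             -- DEFS LEAF №2c-R (idem)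
import Summits.HodgeConjecture.HodgeConjecture.Theorems.F0P3cDyRamFourFrameLawDefsR               -- №1-R (`shiftT shiftR`, idem)
import HarnessLib

/-!
# F0 · P3c · line LH4 «(D-RAM) FOUR-FRAME» — unit (ii-H), child (ρ2b): THE `G`-SIDE OF ROW (2) REDUCED TO THE CENSUS CONSTANT (ρ3c) AND THE TYPE-(2) FIXED-POINT LAW (ρ2b′)
(Rogawski 1990 §4.9 Prop. 4.9.1 (b), §4.3 (4.3.1)–(4.3.2); Kottwitz 1986 §3; Kottwitz 1988 §2)

Cell `pub/hodgecm-mathlib`, crux H413 = `stmt-HodgeConjecture-24833` (helper lane `--supports … --as helper`, count-neutral); THEOREMS ONLY (no definition, no instance,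
no notation, no named fact, no `sorry`, default heartbeats), typed under the LINE FILE's scopes (`open scoped Matrix MatrixGroups Classical ValuativeRel`).  Tree socket
served: (ρ2b) `stub_U2H_gSide_typeTwo_unit0` of `Cruxes/H413/Lines/F0_P3c_DyRamFourFrame_U2H_HSide.lean` (ED. 11 «ROW (2)-SPLIT» 3f8dccf3 :400 ∕ ED. 12 :403; LH4-p06 (g2)
text c4a2f277f1c011e5, digit 183154980): on the type-(2) population near `1 ∈ H_v`,
`Σᶠ_c Δ‴_v(γ_H, out c)·Φ(c, 1_{K_t}; mG₃) = C·Φ^st(γ_H, h_{s_V})∕ν_{s_V} − 2C(q^S − 1)∕(q − 1)` under the (ρ) telescope through `(C, hC)`.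

THE REDUCTION (law-free; every organ is ★ and PLACE-GENERIC — no `|2|_w = 1`, no `σϖ = −ϖ`).
(1) THE TWO CLASSES (★ p847309 `exists_signedPair_finsum_delta_mul_classOrbitalIntegral_eq_mul_sub`): for a type-(2) `γ_H` (`χ_{g,w}` rootless in `L_w`) with one
    match (★ `exists_isLocalNormPair_of_formCongr` at the frame `T = 1`, `(Φ₃)_w = J₀` ★ `placeForm_antidiagThree_eq_over`) there are matches `δ₊, δ₋` of κ-signs `+1, −1` and
    `Σᶠ_c Δ‴_v(γ_H, out c)·Φ(c, f) = τ_v(γ_H, μ)·D_v(γ_H)·(Φ(⟦δ₊⟧, f) − Φ(⟦δ₋⟧, f))` for every `f` and every orbital family.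
(2) THE FIXED-COSET READING (★ `classOrbitalIntegral_indicator_complex_local_eq_natCard_fixedBy_mul`, Kottwitz 1988 §2): `Φ(⟦δ⟧, 1_{K_t}; mG₃) = #Fix_δ(G_v ⧸ K_t)·νG₃(K_t)`
    at each match `δ = δ_±` — regular (★ `isRegularElt_of_isLocalNormPair`, `γ_H` is `G`-regular), compact centraliser (★ p846839
    `compactSpace_centralizer_of_isLocalNormPair_of_not_exists_isRoot_nonsplit`, type (2) at ANY non-split place), `K_t` compact open (★ LH4-p01
    `isCompact_and_isOpen_of_forall_mem_iff_mapGL_eq`), `mG₃` canonical.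
(3) THE CONSTANT: `C = νG₃(K_t)` is the registered child (ρ3c) `stub_U2H_censusConstant_unit0` (★ p855873 `censusConstant_unit0`, PAID ED. 9) — the ONLY place where `hC` enters.
So (ρ2b) ⟸ (ρ3c) ∧ (ρ2b′), where **(ρ2b′) `stub_U2H_fixedPointLaw_typeTwo_unit0`** is law₂ IN FIXED-POINT CURRENCY (C-free, hC-free, no `G`-side measure):
`∃ V ∈ 𝓝 1, ∀ γ_H ∈ V, G-regular → type (2) → ∀ δ₊ δ₋ matched of signs +1 ∕ −1, τ_v(γ_H, μ)·D_v(γ_H)·(#Fix_{δ₊}(G_v ⧸ K_t) − #Fix_{δ₋}(G_v ⧸ K_t)) = Φ^st(γ_H, h_{s_V})∕ν_{s_V} − 2(q^S − 1)∕(q − 1)`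
— the κ-GATED content of ROW (2) (its own later split: the scalar `τ·D = (β, θ)_v·q_v^{−m}` near 1, law-free over ★ T5-u-ANY-PLACE; and the census law proper).

* §1 `finsum_delta_mul_classOrbitalIntegral_indicator_eq_of_typeTwo` — (1)+(2) at one `γ_H`: the κ-orbital integral of `1_{K_t}` on a type-(2) `γ_H` in signed fixed-point currency.
* §2 HEAD **`gSide_typeTwo_unit0_of_const_of_fixedPointLaw`** — (ρ2b)'s conclusion VERBATIM from `hconst : C = νG₃(K_t)` ((ρ3c)'s conclusion) and `hlaw` ((ρ2b′)'s conclusion).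

HONEST LABEL: HC_CM is proved only modulo the 7 printed citations (2 remaining named inputs: hLiu418 = stmt-HodgeConjecture-24832, h413 = stmt-HodgeConjecture-24833) until rung 0
closes; this file is a reduction (count-neutral) — it does NOT assert (ρ2b′), which stays a sorried, κ-gated target.

## References
* [Rogawski1990] J. D. Rogawski, *Automorphic Representations of Unitary Groups in Three Variables*, Ann. of Math. Stud. 123 (1990): §4.9 Prop. 4.9.1 (b) p. 55, Lemma 4.9.3 p. 56;
  §4.3 (4.3.1)–(4.3.2) p. 43; §3.5 Prop. 3.5.2 (c) p. 29.
* [Kottwitz1986BaseChangeUnits] R. E. Kottwitz, *Base change for unit elements of Hecke algebras*, Compositio Math. 60 (1986), §1 pp. 240–241 (orbital integrals of the unit as lattice counts).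
* [Kottwitz1988] R. E. Kottwitz, *Tamagawa numbers*, Ann. of Math. 127 (1988), §2 (orbital integrals of indicators as fixed-coset counts).
* [Flicker1998UnitaryFL] Y. Z. Flicker, *Elementary proof of the fundamental lemma for a unitary group*, Canad. J. Math. 50 (1998), §6 Thm. 18 p. 97.
-/

set_option autoImplicit false

noncomputable section

-- THE LINES MODULE'S `open` CONTEXT (tree `Cruxes/H413/Lines/F0_P3c_DyRamFourFrame_U2H_HSide.lean`, after its `namespace`), so that every shared token elaborates identically:
open MeasureTheory Measure NumberField IsDedekindDomain Topology Filter
open Literature.NumberTheory.Automorphic Literature.NumberTheory.Automorphic.UnitaryGroup Literature.NumberTheory.Automorphic.IntegralReduction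
open Literature.NumberTheory.Rogawski1990 Literature.NumberTheory.GaloisRepresentations
open Literature.NumberTheory.Automorphic.UnitaryThreeFourFrame
open Summit.HodgeConjecture.HodgeConjecture.Cruxes.H413.F0P3cDyRamFourFrameHSideDefs
open Summit.HodgeConjecture.HodgeConjecture.Cruxes.H413.F0P3cDyRamFourFrameHFamilyDefs
open scoped Matrix MatrixGroups Classical ValuativeRel
open Summit.HodgeConjecture.HodgeConjecture.Cruxes.H413.F0P3cDyRamFourFrameHSideDefsR
open Summit.HodgeConjecture.HodgeConjecture.Cruxes.H413.F0P3cDyRamFourFrameLawDefsR (shiftT shiftR)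
open Literature.NumberTheory.Automorphic.UnitaryLatticeTree Literature.NumberTheory.Automorphic.HermitianLattice

namespace Summit.HodgeConjecture.HodgeConjecture.Cruxes.H413.F0P3cDyRamGSideTypeTwoReduction

/-! ## §1 The κ-orbital integral of `1_{K_t}` on one type-(2) `γ_H`, in signed fixed-point currency -/

/-- **THE κ-ORBITAL INTEGRAL OF `1_{K_t}` ON A TYPE-(2) `γ_H`, UNFOLDED** (law-free, place-generic): at a non-split CM place `w ∣ v`, for a `G`-regular `γ_H` whose
`w`-characteristic polynomial has no root in `L_w`, a compact open `K_t ≤ G_v` and the canonical orbital family `mG₃` of a Haar measure `νG₃`, there are matches `δ₊, δ₋` of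
κ-signs `+1, −1`, every match of sign `+1` (resp. `−1`) is conjugate to `δ₊` (resp. `δ₋`), and
`Σᶠ_c Δ‴_v(γ_H, out c)·Φ(c, 1_{K_t}; mG₃) = τ_v(γ_H, μ)·D_v(γ_H)·νG₃(K_t)·(#Fix_{δ₊}(G_v ⧸ K_t) − #Fix_{δ₋}(G_v ⧸ K_t))`.
[cite: Rogawski1990, §4.3 (4.3.1)–(4.3.2) p. 43; §4.9 Prop. 4.9.1 (b) p. 55] [cite: Kottwitz1988, §2] [cite: Flicker1998UnitaryFL, Theorem 18 p. 97] -/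
theorem finsum_delta_mul_classOrbitalIntegral_indicator_eq_of_typeTwo (L : Type) [Field L] [NumberField L] [IsCMField L]
    {v : HeightOneSpectrum (𝓞 ↥(maximalRealSubfield L))} (w : UnitaryGroup.PlacesOver L v) (hw : IsCMField.complexConj L • w.1 = w.1)
    (μ : HeckeCharacter L)
      [MeasurableSpace ((UnitaryGroup.cmDatum L 3 (Matrix.of fun i j : Fin 3 => if i.val + j.val + 1 = 3 then (1 : L) else 0)).Local v)] [BorelSpace ((UnitaryGroup.cmDatum L 3 (Matrix.of fun i j : Fin 3 => if i.val + j.val + 1 = 3 then (1 : L) else 0)).Local v)]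
      [∀ γ : ((UnitaryGroup.cmDatum L 3 (Matrix.of fun i j : Fin 3 => if i.val + j.val + 1 = 3 then (1 : L) else 0)).Local v), MeasurableSpace (((UnitaryGroup.cmDatum L 3 (Matrix.of fun i j : Fin 3 => if i.val + j.val + 1 = 3 then (1 : L) else 0)).Local v) ⧸ Subgroup.centralizer ({γ} : Set ((UnitaryGroup.cmDatum L 3 (Matrix.of fun i j : Fin 3 => if i.val + j.val + 1 = 3 then (1 : L) else 0)).Local v)))]
      [∀ γ : ((UnitaryGroup.cmDatum L 3 (Matrix.of fun i j : Fin 3 => if i.val + j.val + 1 = 3 then (1 : L) else 0)).Local v), BorelSpace (((UnitaryGroup.cmDatum L 3 (Matrix.of fun i j : Fin 3 => if i.val + j.val + 1 = 3 then (1 : L) else 0)).Local v) ⧸ Subgroup.centralizer ({γ} : Set ((UnitaryGroup.cmDatum L 3 (Matrix.of fun i j : Fin 3 => if i.val + j.val + 1 = 3 then (1 : L) else 0)).Local v)))]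
      (νG₃ : Measure ((UnitaryGroup.cmDatum L 3 (Matrix.of fun i j : Fin 3 => if i.val + j.val + 1 = 3 then (1 : L) else 0)).Local v)) [νG₃.IsHaarMeasure] [νG₃.IsMulRightInvariant]
    (mG₃ : OrbitalMeasureFamily ((UnitaryGroup.cmDatum L 3 (Matrix.of fun i j : Fin 3 => if i.val + j.val + 1 = 3 then (1 : L) else 0)).Local v)) (hmG : mG₃.IsCanonical (fun γ => IsRegularElt (γ.val : GL (Fin 3) (UnitaryGroup.LocalRing L v))) νG₃)
    (Kt : Subgroup ((UnitaryGroup.cmDatum L 3 (Matrix.of fun i j : Fin 3 => if i.val + j.val + 1 = 3 then (1 : L) else 0)).Local v)) (hKo : IsOpen (Kt : Set ((UnitaryGroup.cmDatum L 3 (Matrix.of fun i j : Fin 3 => if i.val + j.val + 1 = 3 then (1 : L) else 0)).Local v))) (hKc : IsCompact (Kt : Set ((UnitaryGroup.cmDatum L 3 (Matrix.of fun i j : Fin 3 => if i.val + j.val + 1 = 3 then (1 : L) else 0)).Local v)))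
    {γH : ((UnitaryGroup.cmDatum L 2 (Matrix.of fun i j : Fin 2 => if i.val + j.val + 1 = 2 then (1 : L) else 0)).Local v × (UnitaryGroup.cmDatum L 1 (Matrix.of fun i j : Fin 1 => if i.val + j.val + 1 = 1 then (1 : L) else 0)).Local v)}
    (hreg : IsLocalGRegular L v γH)
    (hirr : ¬ (∃ x : (w.1.adicCompletion L), (((((γH).1.val : GL (Fin 2) (UnitaryGroup.LocalRing L v)).val.map (Pi.evalRingHom (fun w' : UnitaryGroup.PlacesOver L v => w'.1.adicCompletion L) w))).charpoly).IsRoot x)) :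
    ∃ δp δm : ((UnitaryGroup.cmDatum L 3 (Matrix.of fun i j : Fin 3 => if i.val + j.val + 1 = 3 then (1 : L) else 0)).Local v),
      IsLocalNormPair L (Matrix.of fun i j : Fin 3 => if i.val + j.val + 1 = 3 then (1 : L) else 0) v γH δp ∧ finKappaAt L v (Matrix.of fun i j : Fin 3 => if i.val + j.val + 1 = 3 then (1 : L) else 0) γH δp = 1 ∧ IsLocalNormPair L (Matrix.of fun i j : Fin 3 => if i.val + j.val + 1 = 3 then (1 : L) else 0) v γH δm ∧ finKappaAt L v (Matrix.of fun i j : Fin 3 => if i.val + j.val + 1 = 3 then (1 : L) else 0) γH δm = -1 ∧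
      (∀ δ : ((UnitaryGroup.cmDatum L 3 (Matrix.of fun i j : Fin 3 => if i.val + j.val + 1 = 3 then (1 : L) else 0)).Local v), IsLocalNormPair L (Matrix.of fun i j : Fin 3 => if i.val + j.val + 1 = 3 then (1 : L) else 0) v γH δ → finKappaAt L v (Matrix.of fun i j : Fin 3 => if i.val + j.val + 1 = 3 then (1 : L) else 0) γH δ = 1 → IsConj δp δ) ∧
      (∀ δ : ((UnitaryGroup.cmDatum L 3 (Matrix.of fun i j : Fin 3 => if i.val + j.val + 1 = 3 then (1 : L) else 0)).Local v), IsLocalNormPair L (Matrix.of fun i j : Fin 3 => if i.val + j.val + 1 = 3 then (1 : L) else 0) v γH δ → finKappaAt L v (Matrix.of fun i j : Fin 3 => if i.val + j.val + 1 = 3 then (1 : L) else 0) γH δ = -1 → IsConj δm δ) ∧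
      ∑ᶠ c : ConjClasses ((UnitaryGroup.cmDatum L 3 (Matrix.of fun i j : Fin 3 => if i.val + j.val + 1 = 3 then (1 : L) else 0)).Local v), ((finExplicitCollection L (Matrix.of fun i j : Fin 3 => if i.val + j.val + 1 = 3 then (1 : L) else 0) μ (finExplicitDelta_conj_left_all L (Matrix.of fun i j : Fin 3 => if i.val + j.val + 1 = 3 then (1 : L) else 0) μ) (finExplicitDelta_conj_right_all L (Matrix.of fun i j : Fin 3 => if i.val + j.val + 1 = 3 then (1 : L) else 0) μ)) v).Δ γH (Quotient.out c) * classOrbitalIntegral mG₃ (Set.indicator (Kt : Set ((UnitaryGroup.cmDatum L 3 (Matrix.of fun i j : Fin 3 => if i.val + j.val + 1 = 3 then (1 : L) else 0)).Local v)) (fun _ => (1 : ℂ))) c =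
        finTau L v γH μ * (finWeylRatio L v γH : ℂ) * (((νG₃ Kt).toReal : ℂ) * ((Nat.card (MulAction.fixedBy (((UnitaryGroup.cmDatum L 3 (Matrix.of fun i j : Fin 3 => if i.val + j.val + 1 = 3 then (1 : L) else 0)).Local v) ⧸ Kt) δp) : ℂ) - (Nat.card (MulAction.fixedBy (((UnitaryGroup.cmDatum L 3 (Matrix.of fun i j : Fin 3 => if i.val + j.val + 1 = 3 then (1 : L) else 0)).Local v) ⧸ Kt) δm) : ℂ))) := by
  have hH : ((Matrix.of fun i j : Fin 3 => if i.val + j.val + 1 = 3 then (1 : L) else 0).map (cmConjRingHom L))ᵀ = (Matrix.of fun i j : Fin 3 => if i.val + j.val + 1 = 3 then (1 : L) else 0) := antidiagOne_isHermitian L 3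
  have hdet : (Matrix.of fun i j : Fin 3 => if i.val + j.val + 1 = 3 then (1 : L) else 0).det ≠ 0 := (isUnit_antidiagOne_det L 3).ne_zero
  have hH'u : IsUnit (Matrix.of fun i j : Fin 3 => if i.val + j.val + 1 = 3 then (1 : L) else 0) := (Matrix.isUnit_iff_isUnit_det _).2 (isUnit_antidiagOne_det L 3)
  -- one match exists (frame `T = 1`: `(Φ₃)_w = J₀`)
  obtain ⟨b, hb⟩ := exists_isLocalNormPair_of_formCongr L (Matrix.of fun i j : Fin 3 => if i.val + j.val + 1 = 3 then (1 : L) else 0) w hw (1 : GL (Fin 3) (w.1.adicCompletion L)) (c := (1 : w.1.adicCompletion L)) isUnit_one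
    (by rw [one_smul, placeForm_antidiagThree_eq_over L w, formCongr_one_eq]) γH
  -- the two classes and their exhaustion
  obtain ⟨δp, δm, hp, hκp, hm, hκm, hexp, hexm, hsum⟩ :=
    exists_signedPair_finsum_delta_mul_classOrbitalIntegral_eq_mul_sub L (Matrix.of fun i j : Fin 3 => if i.val + j.val + 1 = 3 then (1 : L) else 0) hH hdet w hw μ
      (finExplicitDelta_conj_left_all L (Matrix.of fun i j : Fin 3 => if i.val + j.val + 1 = 3 then (1 : L) else 0) μ) (finExplicitDelta_conj_right_all L (Matrix.of fun i j : Fin 3 => if i.val + j.val + 1 = 3 then (1 : L) else 0) μ) hirr hb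
  refine ⟨δp, δm, hp, hκp, hm, hκm, hexp, hexm, ?_⟩
  rw [hsum mG₃ (Set.indicator (Kt : Set ((UnitaryGroup.cmDatum L 3 (Matrix.of fun i j : Fin 3 => if i.val + j.val + 1 = 3 then (1 : L) else 0)).Local v)) (fun _ => (1 : ℂ)))]
  -- the fixed-coset reading at `δ₊`, `δ₋`
  haveI := compactSpace_centralizer_of_isLocalNormPair_of_not_exists_isRoot_nonsplit L v w hw hH'u hreg hirr δp hp
  haveI := compactSpace_centralizer_of_isLocalNormPair_of_not_exists_isRoot_nonsplit L v w hw hH'u hreg hirr δm hm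
  have hregp : IsRegularElt (δp.val : GL (Fin 3) (UnitaryGroup.LocalRing L v)) := isRegularElt_of_isLocalNormPair L (Matrix.of fun i j : Fin 3 => if i.val + j.val + 1 = 3 then (1 : L) else 0) v hp hreg
  have hregm : IsRegularElt (δm.val : GL (Fin 3) (UnitaryGroup.LocalRing L v)) := isRegularElt_of_isLocalNormPair L (Matrix.of fun i j : Fin 3 => if i.val + j.val + 1 = 3 then (1 : L) else 0) v hm hreg
  rw [classOrbitalIntegral_indicator_complex_local_eq_natCard_fixedBy_mul L 3 (Matrix.of fun i j : Fin 3 => if i.val + j.val + 1 = 3 then (1 : L) else 0) v νG₃ hH hdet hmG Kt hKo hKc δp hregp,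
    classOrbitalIntegral_indicator_complex_local_eq_natCard_fixedBy_mul L 3 (Matrix.of fun i j : Fin 3 => if i.val + j.val + 1 = 3 then (1 : L) else 0) v νG₃ hH hdet hmG Kt hKo hKc δm hregm]
  ring

/-! ## §2 HEAD: (ρ2b) from (ρ3c) and (ρ2b′) -/

/-- **(ρ2b) THE `G`-SIDE OF ROW (2), FROM THE CENSUS CONSTANT AND THE TYPE-(2) FIXED-POINT LAW** — (ρ2b)'s conclusion VERBATIM (LH4-p06 (g2) text c4a2f277f1c011e5):
given `hconst : C = νG₃(K_t)` (the conclusion of the registered child (ρ3c) `stub_U2H_censusConstant_unit0`, ★ `censusConstant_unit0`) and `hlaw` (the conclusion of the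
registered child (ρ2b′) `stub_U2H_fixedPointLaw_typeTwo_unit0`: law₂ in fixed-point currency), on `hlaw`'s neighbourhood `V` of `1 ∈ H_v`, for every `G`-regular type-(2)
`γ_H ∈ V`: `Σᶠ_c Δ‴_v(γ_H, out c)·Φ(c, 1_{K_t}; mG₃) = C·Φ^st(γ_H, h_{s_V})∕ν_{s_V} − 2C(q^S − 1)∕(q − 1)` — §1 at `γ_H` (`K_t` compact open by ★ LH4-p01), then `hlaw` at
the signed pair `(δ₊, δ₋)` and `hconst`.  Composition line for the Lines module:
`(ρ2b) := fun L _ _ _ _ w hw he h2 ϖ hϖ d tE hD _ δ hδ hδ0 μ hμu hμω _ _ _ _ _ _ _ _ νH _ _ νG₃ _ _ mH mG₃ hmH hmG N hN Kt hKt C hC =>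
  gSide_typeTwo_unit0_of_const_of_fixedPointLaw L w hw he ϖ hϖ d tE μ νH νG₃ mH mG₃ hmG N hN Kt hKt C ((ρ3c) … C hC) ((ρ2b′) …)`.
[cite: Rogawski1990, §4.9 Prop. 4.9.1 (b) p. 55, Lemma 4.9.3 p. 56; §4.3 (4.3.1)–(4.3.2) p. 43] [cite: Kottwitz1986BaseChangeUnits, §1 pp. 240–241] [cite: Kottwitz1988, §2] -/
theorem gSide_typeTwo_unit0_of_const_of_fixedPointLaw (L : Type) [Field L] [NumberField L] [IsCMField L]
    {v : HeightOneSpectrum (𝓞 ↥(maximalRealSubfield L))} (w : UnitaryGroup.PlacesOver L v)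
    (hw : IsCMField.complexConj L • w.1 = w.1) (he : v.asIdeal.ramificationIdx' w.1.asIdeal ≠ 1)
    (ϖ : (w.1.adicCompletion L)) (hϖ : Valued.v ϖ = WithZero.exp (-1 : ℤ)) (d tE : ℕ)
    [Fintype (Valued.ResidueField (w.1.adicCompletion L))] (μ : HeckeCharacter L)
    [MeasurableSpace ((UnitaryGroup.cmDatum L 3 (Matrix.of fun i j : Fin 3 => if i.val + j.val + 1 = 3 then (1 : L) else 0)).Local v)] [BorelSpace ((UnitaryGroup.cmDatum L 3 (Matrix.of fun i j : Fin 3 => if i.val + j.val + 1 = 3 then (1 : L) else 0)).Local v)]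
    [∀ γ : ((UnitaryGroup.cmDatum L 3 (Matrix.of fun i j : Fin 3 => if i.val + j.val + 1 = 3 then (1 : L) else 0)).Local v), MeasurableSpace (((UnitaryGroup.cmDatum L 3 (Matrix.of fun i j : Fin 3 => if i.val + j.val + 1 = 3 then (1 : L) else 0)).Local v) ⧸ Subgroup.centralizer ({γ} : Set ((UnitaryGroup.cmDatum L 3 (Matrix.of fun i j : Fin 3 => if i.val + j.val + 1 = 3 then (1 : L) else 0)).Local v)))]
    [∀ γ : ((UnitaryGroup.cmDatum L 3 (Matrix.of fun i j : Fin 3 => if i.val + j.val + 1 = 3 then (1 : L) else 0)).Local v), BorelSpace (((UnitaryGroup.cmDatum L 3 (Matrix.of fun i j : Fin 3 => if i.val + j.val + 1 = 3 then (1 : L) else 0)).Local v) ⧸ Subgroup.centralizer ({γ} : Set ((UnitaryGroup.cmDatum L 3 (Matrix.of fun i j : Fin 3 => if i.val + j.val + 1 = 3 then (1 : L) else 0)).Local v)))]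
    [MeasurableSpace ((UnitaryGroup.cmDatum L 2 (Matrix.of fun i j : Fin 2 => if i.val + j.val + 1 = 2 then (1 : L) else 0)).Local v × (UnitaryGroup.cmDatum L 1 (Matrix.of fun i j : Fin 1 => if i.val + j.val + 1 = 1 then (1 : L) else 0)).Local v)] [BorelSpace ((UnitaryGroup.cmDatum L 2 (Matrix.of fun i j : Fin 2 => if i.val + j.val + 1 = 2 then (1 : L) else 0)).Local v × (UnitaryGroup.cmDatum L 1 (Matrix.of fun i j : Fin 1 => if i.val + j.val + 1 = 1 then (1 : L) else 0)).Local v)]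
    [∀ a : ((UnitaryGroup.cmDatum L 2 (Matrix.of fun i j : Fin 2 => if i.val + j.val + 1 = 2 then (1 : L) else 0)).Local v × (UnitaryGroup.cmDatum L 1 (Matrix.of fun i j : Fin 1 => if i.val + j.val + 1 = 1 then (1 : L) else 0)).Local v), MeasurableSpace (((UnitaryGroup.cmDatum L 2 (Matrix.of fun i j : Fin 2 => if i.val + j.val + 1 = 2 then (1 : L) else 0)).Local v × (UnitaryGroup.cmDatum L 1 (Matrix.of fun i j : Fin 1 => if i.val + j.val + 1 = 1 then (1 : L) else 0)).Local v) ⧸ Subgroup.centralizer ({a} : Set ((UnitaryGroup.cmDatum L 2 (Matrix.of fun i j : Fin 2 => if i.val + j.val + 1 = 2 then (1 : L) else 0)).Local v × (UnitaryGroup.cmDatum L 1 (Matrix.of fun i j : Fin 1 => if i.val + j.val + 1 = 1 then (1 : L) else 0)).Local v)))]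
    [∀ a : ((UnitaryGroup.cmDatum L 2 (Matrix.of fun i j : Fin 2 => if i.val + j.val + 1 = 2 then (1 : L) else 0)).Local v × (UnitaryGroup.cmDatum L 1 (Matrix.of fun i j : Fin 1 => if i.val + j.val + 1 = 1 then (1 : L) else 0)).Local v), BorelSpace (((UnitaryGroup.cmDatum L 2 (Matrix.of fun i j : Fin 2 => if i.val + j.val + 1 = 2 then (1 : L) else 0)).Local v × (UnitaryGroup.cmDatum L 1 (Matrix.of fun i j : Fin 1 => if i.val + j.val + 1 = 1 then (1 : L) else 0)).Local v) ⧸ Subgroup.centralizer ({a} : Set ((UnitaryGroup.cmDatum L 2 (Matrix.of fun i j : Fin 2 => if i.val + j.val + 1 = 2 then (1 : L) else 0)).Local v × (UnitaryGroup.cmDatum L 1 (Matrix.of fun i j : Fin 1 => if i.val + j.val + 1 = 1 then (1 : L) else 0)).Local v)))]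
    (νH : Measure ((UnitaryGroup.cmDatum L 2 (Matrix.of fun i j : Fin 2 => if i.val + j.val + 1 = 2 then (1 : L) else 0)).Local v × (UnitaryGroup.cmDatum L 1 (Matrix.of fun i j : Fin 1 => if i.val + j.val + 1 = 1 then (1 : L) else 0)).Local v)) [νH.IsHaarMeasure] [νH.IsMulRightInvariant]
    (νG₃ : Measure ((UnitaryGroup.cmDatum L 3 (Matrix.of fun i j : Fin 3 => if i.val + j.val + 1 = 3 then (1 : L) else 0)).Local v)) [νG₃.IsHaarMeasure] [νG₃.IsMulRightInvariant]
    (mH : OrbitalMeasureFamily ((UnitaryGroup.cmDatum L 2 (Matrix.of fun i j : Fin 2 => if i.val + j.val + 1 = 2 then (1 : L) else 0)).Local v × (UnitaryGroup.cmDatum L 1 (Matrix.of fun i j : Fin 1 => if i.val + j.val + 1 = 1 then (1 : L) else 0)).Local v)) (mG₃ : OrbitalMeasureFamily ((UnitaryGroup.cmDatum L 3 (Matrix.of fun i j : Fin 3 => if i.val + j.val + 1 = 3 then (1 : L) else 0)).Local v))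
    (hmG : mG₃.IsCanonical (fun γ => IsRegularElt (γ.val : GL (Fin 3) (UnitaryGroup.LocalRing L v))) νG₃)
    (N : Submodule (Valued.integer (w.1.adicCompletion L)) (Fin 3 → (w.1.adicCompletion L))) (hN : IsVertexLattice (galAdicCompletionMap (L := L) (IsCMField.complexConj L) hw) ϖ ((StdForm.antidiagonal 3).over (w.1.adicCompletion L)) 0 N)
    (Kt : Subgroup ((UnitaryGroup.cmDatum L 3 (Matrix.of fun i j : Fin 3 => if i.val + j.val + 1 = 3 then (1 : L) else 0)).Local v)) (hKt : ∀ u : ((UnitaryGroup.cmDatum L 3 (Matrix.of fun i j : Fin 3 => if i.val + j.val + 1 = 3 then (1 : L) else 0)).Local v), u ∈ Kt ↔ mapGL ((localNonsplitEquiv (IsCMField.complexConj L) (Matrix.of fun i j : Fin 3 => if i.val + j.val + 1 = 3 then (1 : L) else 0) (IsCMField.complexConj_ne_one L) w hw u :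
    ↥(unitaryGroupOfForm (galAdicCompletionMap (L := L) (IsCMField.complexConj L) hw) (placeForm (Matrix.of fun i j : Fin 3 => if i.val + j.val + 1 = 3 then (1 : L) else 0) w.1))) : GL (Fin 3) (w.1.adicCompletion L)) N = N)
    (C : ℂ) (hconst : C = ((νG₃.real (Kt : Set ((UnitaryGroup.cmDatum L 3 (Matrix.of fun i j : Fin 3 => if i.val + j.val + 1 = 3 then (1 : L) else 0)).Local v)) : ℝ) : ℂ))
    (hlaw : ∃ V ∈ 𝓝 (1 : ((UnitaryGroup.cmDatum L 2 (Matrix.of fun i j : Fin 2 => if i.val + j.val + 1 = 2 then (1 : L) else 0)).Local v × (UnitaryGroup.cmDatum L 1 (Matrix.of fun i j : Fin 1 => if i.val + j.val + 1 = 1 then (1 : L) else 0)).Local v)), ∀ γH ∈ V, IsLocalGRegular L v γH →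
      ¬ (∃ x : (w.1.adicCompletion L), (((((γH).1.val : GL (Fin 2) (UnitaryGroup.LocalRing L v)).val.map (Pi.evalRingHom (fun w' : UnitaryGroup.PlacesOver L v => w'.1.adicCompletion L) w))).charpoly).IsRoot x) →
      ∀ (δp δm : ((UnitaryGroup.cmDatum L 3 (Matrix.of fun i j : Fin 3 => if i.val + j.val + 1 = 3 then (1 : L) else 0)).Local v)), IsLocalNormPair L (Matrix.of fun i j : Fin 3 => if i.val + j.val + 1 = 3 then (1 : L) else 0) v γH δp → finKappaAt L v (Matrix.of fun i j : Fin 3 => if i.val + j.val + 1 = 3 then (1 : L) else 0) γH δp = 1 → IsLocalNormPair L (Matrix.of fun i j : Fin 3 => if i.val + j.val + 1 = 3 then (1 : L) else 0) v γH δm → finKappaAt L v (Matrix.of fun i j : Fin 3 => if i.val + j.val + 1 = 3 then (1 : L) else 0) γH δm = -1 →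
      finTau L v γH μ * (finWeylRatio L v γH : ℂ) * ((Nat.card (MulAction.fixedBy (((UnitaryGroup.cmDatum L 3 (Matrix.of fun i j : Fin 3 => if i.val + j.val + 1 = 3 then (1 : L) else 0)).Local v) ⧸ Kt) δp) : ℂ) - (Nat.card (MulAction.fixedBy (((UnitaryGroup.cmDatum L 3 (Matrix.of fun i j : Fin 3 => if i.val + j.val + 1 = 3 then (1 : L) else 0)).Local v) ⧸ Kt) δm) : ℂ)) =
      (if d % 2 = 1 then stableOrbitalIntegralRel (IsLocalStablyConjH L v) mH (hFamily L w hw ϖ 1) γH / (νH.real (Function.support (hFamily L w hw ϖ 1)) : ℂ) else stableOrbitalIntegralRel (IsLocalStablyConjH L v) mH (hFamily L w hw ϖ 0) γH / (νH.real (Function.support (hFamily L w hw ϖ 0)) : ℂ)) - 2 * (((Fintype.card (Valued.ResidueField (w.1.adicCompletion L)) : ℕ) : ℂ) ^ (shiftR d tE) - 1) / (((Fintype.card (Valued.ResidueField (w.1.adicCompletion L)) : ℕ) : ℂ) - 1)) :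
    ∃ V ∈ 𝓝 (1 : ((UnitaryGroup.cmDatum L 2 (Matrix.of fun i j : Fin 2 => if i.val + j.val + 1 = 2 then (1 : L) else 0)).Local v × (UnitaryGroup.cmDatum L 1 (Matrix.of fun i j : Fin 1 => if i.val + j.val + 1 = 1 then (1 : L) else 0)).Local v)), ∀ γH ∈ V, IsLocalGRegular L v γH →
      ¬ (∃ x : (w.1.adicCompletion L), (((((γH).1.val : GL (Fin 2) (UnitaryGroup.LocalRing L v)).val.map (Pi.evalRingHom (fun w' : UnitaryGroup.PlacesOver L v => w'.1.adicCompletion L) w))).charpoly).IsRoot x) →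
      ∑ᶠ c : ConjClasses ((UnitaryGroup.cmDatum L 3 (Matrix.of fun i j : Fin 3 => if i.val + j.val + 1 = 3 then (1 : L) else 0)).Local v), ((finExplicitCollection L (Matrix.of fun i j : Fin 3 => if i.val + j.val + 1 = 3 then (1 : L) else 0) μ (finExplicitDelta_conj_left_all L (Matrix.of fun i j : Fin 3 => if i.val + j.val + 1 = 3 then (1 : L) else 0) μ) (finExplicitDelta_conj_right_all L (Matrix.of fun i j : Fin 3 => if i.val + j.val + 1 = 3 then (1 : L) else 0) μ)) v).Δ γH (Quotient.out c) * classOrbitalIntegral mG₃ (Set.indicator (Kt : Set ((UnitaryGroup.cmDatum L 3 (Matrix.of fun i j : Fin 3 => if i.val + j.val + 1 = 3 then (1 : L) else 0)).Local v)) (fun _ => (1 : ℂ))) c =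
      C * (if d % 2 = 1 then stableOrbitalIntegralRel (IsLocalStablyConjH L v) mH (hFamily L w hw ϖ 1) γH / (νH.real (Function.support (hFamily L w hw ϖ 1)) : ℂ) else stableOrbitalIntegralRel (IsLocalStablyConjH L v) mH (hFamily L w hw ϖ 0) γH / (νH.real (Function.support (hFamily L w hw ϖ 0)) : ℂ)) - 2 * C * (((Fintype.card (Valued.ResidueField (w.1.adicCompletion L)) : ℕ) : ℂ) ^ (shiftR d tE) - 1) / (((Fintype.card (Valued.ResidueField (w.1.adicCompletion L)) : ℕ) : ℂ) - 1) := by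
  obtain ⟨V, hV, hL⟩ := hlaw
  refine ⟨V, hV, fun γH hγV hreg hirr => ?_⟩
  -- `K_t` is compact open (the stabiliser of a type-0 vertex)
  obtain ⟨hKc, hKo⟩ := F0P3cDyRamAnchorCountDictionaryZero.isCompact_and_isOpen_of_forall_mem_iff_mapGL_eq L w hw he hϖ hN Kt hKt
  -- §1 at `γ_H`
  obtain ⟨δp, δm, hp, hκp, hm, hκm, -, -, hsum⟩ :=
    finsum_delta_mul_classOrbitalIntegral_indicator_eq_of_typeTwo L w hw μ νG₃ mG₃ hmG Kt hKo hKc hreg hirr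
  rw [hsum]
  -- the law at the signed pair, and the constant
  have hlawp := hL γH hγV hreg hirr δp δm hp hκp hm hκm
  have hν : ((νG₃ Kt).toReal : ℂ) = C := by rw [hconst]; rfl
  rw [hν]
  linear_combination C * hlawp

end Summit.HodgeConjecture.HodgeConjecture.Cruxes.H413.F0P3cDyRamGSideTypeTwoReduction

end
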